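import Literature.Computability.MetaComplexity.PolynomialCalculusRespectfulExpander
import HarnessLib

/-!
# Mikša–Nordström's generalised Alekhnovich–Razborov degree lower bound (CCC 2015, Thm 3.6), proved

The main technical theorem of Mikša–Nordström, *A generalized method for proving polynomial calculus
degree lower bounds* (CCC 2015, Thm 3.6 = arXiv:1505.01358 Thm 11): if `(𝓕, 𝒱)_E` is an
`(s, δ, ξ, E)`-respectful boundary expander with overlap `≤ ℓ` (every variable lies in at most `ℓ`
of the sets `𝒱 k`), every `𝒱 k` respects `E`, and `⋀_{i ∈ S} 𝓕 i ∧ E` is satisfiable whenever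
`|S| ≤ s`, then every CNF `φ` whose clauses are clauses of `E` or of the `𝓕 i` has NO polynomial
calculus refutation (Krajíček's `PC.DerivableInDegree`, any field) of degree `≤ D` for any
`D ≤ (δs - 2ξ)/(2ℓ)` (`MiksaNordstrom.not_refutableInDegree`, next file).  This file: the operator and
its locality.

Proof = MN15 §3.3–3.5 with the operator `R(t) := R_{⟨Sup(t) ∧ E⟩}(t)` (`Lmon`, `L`): the residue
of `PolynomialCalculusResidue*.lean` relative to the common roots `locSol` of `Sup(N(t)) ∧ E`, where
`Sup` is the support closure `msupp` of `PolynomialCalculusRespectfulExpander.lean` (Galesi–Lauria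
style least closed set — see that file's docstring for why; it makes MN15's degree-graded order
unnecessary).  `residue_locSol_eq` is MN15 Lemma 3.9/3.11 (arXiv 27/29: enlarging the ideal by at
most `s/2` subformulas beyond the support does not change the residue — removal of one subformula at
a time through an escaping respectful boundary set), `nbhd_residue_subset` is Lemma 3.10 (arXiv 28),
`L_eq_zero_of_local` / `L_one` are two of the three properties of MN15's arXiv Lemma 16 (`R(axiom) = 0`,
`R(1) ≠ 0`); the third (`R(xt) = R(x R(t))`), the induction over the derivation and the theorem
itself are in `PolynomialCalculusRespectfulExpanderTheorem.lean`.

Source: M. Mikša, J. Nordström, CCC 2015 (LIPIcs 33) §3 = arXiv:1505.01358 §3.3–3.5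
[MiksaNordstrom2015] (held copy `paper:arxiv-1505.01358`).  Hypotheses made explicit: `0 < δ`,
`2 ≤ s`, `1 ≤ ℓ` (MN15's applications have `s = Θ(n)`, constant `ℓ ≥ 1`).
-/

noncomputable section

namespace Literature.Computability.MetaComplexity

namespace MiksaNordstrom

open Finset MvPolynomial Literature.Computability.Complexity PCResidue

/-- Colex on finite sets of naturals is well founded. [folklore] -/
private theorem wf_colex_nat : WellFoundedLT (Colex (Finset ℕ)) :=
  Finset.orderIsoColex.symm.toOrderEmbedding.wellFoundedLT

-- `Prop`-valued, absent from Mathlib for this type, proof-irrelevant: cannot override anything.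
attribute [local instance] wf_colex_nat

variable {ι κ : Type*} [Fintype ι] [DecidableEq ι] [Fintype κ]
variable (𝓕 : ι → CNF ℕ) (𝒱 : κ → Finset ℕ) (E : CNF ℕ) (s : ℝ) {K : Type*} [Field K]

/-! ### Neighbourhoods of monomials and the operator -/

/-- `N(t)`: the variable sets containing a variable of the monomial `t`. [Mikša–Nordström 2015,
§3.3, arXiv:1505.01358 Def. 20 (p. 12) — the arXiv numbering is the checkable locator on the held
copy] [cite: MiksaNordstrom2015, Definition 3.8 (arXiv Def. 20)] -/
def nbhd (t : ℕ →₀ ℕ) : Finset κ := by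
  classical exact Finset.univ.filter fun k => ∃ j ∈ t.support, j ∈ 𝒱 k

variable (K) in
/-- `R` on a monomial: `R(t) := R_{⟨Sup(t) ∧ E⟩}(t)`. [Mikša–Nordström 2015, §3.3,
arXiv:1505.01358 Def. 24 (p. 13) — the arXiv numbering is the checkable locator on the held copy]
[cite: MiksaNordstrom2015, Definition 3.11 (arXiv Def. 24)] -/
def Lmon (t : ℕ →₀ ℕ) : MvPolynomial ℕ K :=
  residue (locSol 𝓕 E (msupp 𝓕 𝒱 E s (nbhd 𝒱 t))) (monomial t (1 : K))

variable (K) in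
/-- **The operator `R`**, "the linear extension of the operator defined on terms".
[Mikša–Nordström 2015, arXiv Def. 24] [cite: MiksaNordstrom2015, Definition 3.11] -/
def L : MvPolynomial ℕ K →ₗ[K] MvPolynomial ℕ K :=
  (basisMonomials ℕ K).constr K (Lmon 𝓕 𝒱 E s K)

variable {𝓕 𝒱 E s}

/-- Membership in `N(t)`. [Mikša–Nordström 2015, arXiv Def. 20] [cite: MiksaNordstrom2015, Definition 3.8] -/
theorem mem_nbhd {t : ℕ →₀ ℕ} {k : κ} : k ∈ nbhd 𝒱 t ↔ ∃ j ∈ t.support, j ∈ 𝒱 k := by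
  classical
  simp [nbhd]

/-- `N` is monotone in the variables of the monomial. [Mikša–Nordström 2015, arXiv Obs. 22]
[cite: MiksaNordstrom2015, Observation 3.9] -/
theorem nbhd_mono {t t' : ℕ →₀ ℕ} (h : t.support ⊆ t'.support) : nbhd 𝒱 t ⊆ nbhd 𝒱 t' :=
  fun k hk => by
    obtain ⟨j, hj, hjk⟩ := mem_nbhd.1 hk
    exact mem_nbhd.2 ⟨j, h hj, hjk⟩

/-- Overlap `≤ ℓ` bounds `|N(t)|` by `ℓ` times the number of variables of `t`. [Mikša–Nordström 2015,
proof of Lemma 3.12 (arXiv Lemma 30)] [cite: MiksaNordstrom2015, Lemma 3.12] -/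
theorem card_nbhd_le {ℓ : ℕ} (hover : ∀ x : ℕ, (Finset.univ.filter fun k => x ∈ 𝒱 k).card ≤ ℓ)
    (t : ℕ →₀ ℕ) : (nbhd 𝒱 t).card ≤ ℓ * t.support.card := by
  classical
  have hsub : nbhd 𝒱 t ⊆ t.support.biUnion fun x => Finset.univ.filter fun k => x ∈ 𝒱 k := by
    intro k hk
    obtain ⟨j, hj, hjk⟩ := mem_nbhd.1 hk
    exact Finset.mem_biUnion.2 ⟨j, hj, by simp [hjk]⟩
  refine (Finset.card_le_card hsub).trans ?_
  rw [mul_comm]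
  exact Finset.card_biUnion_le_card_mul _ _ _ fun x _ => hover x

/-- `R` on a monomial with a coefficient. [Mikša–Nordström 2015, arXiv Def. 24]
[cite: MiksaNordstrom2015, Definition 3.11] -/
theorem L_monomial (t : ℕ →₀ ℕ) (a : K) : L 𝓕 𝒱 E s K (monomial t a) = a • Lmon 𝓕 𝒱 E s K t := by
  have h1 : L 𝓕 𝒱 E s K (monomial t (1 : K)) = Lmon 𝓕 𝒱 E s K t := by
    have := (basisMonomials ℕ K).constr_basis K (Lmon 𝓕 𝒱 E s K) t
    rwa [coe_basisMonomials] at this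
  rw [show monomial t a = a • monomial t (1 : K) by rw [smul_monomial, smul_eq_mul, mul_one],
    map_smul, h1]

/-- `R` as a sum over monomials. [Mikša–Nordström 2015, arXiv Def. 24]
[cite: MiksaNordstrom2015, Definition 3.11] -/
theorem L_eq_sum (p : MvPolynomial ℕ K) :
    L 𝓕 𝒱 E s K p = ∑ t ∈ p.support, coeff t p • Lmon 𝓕 𝒱 E s K t := by
  conv_lhs => rw [p.as_sum, map_sum]
  exact Finset.sum_congr rfl fun t _ => L_monomial t _

/-! ### Lemmas 3.9–3.11 -/

/-- A polynomial not mentioning `𝒱 k` is fixed by any restriction on `𝒱 k` ("`α` does not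
assign any variables in `t'`"). [Mikša–Nordström 2015, proof of Lemma 3.9]
[cite: MiksaNordstrom2015, Lemma 3.9] -/
theorem restrictBy_toRestr_eq_self {U : Finset κ} {p : MvPolynomial ℕ K}
    (hp : ∀ t ∈ p.support, nbhd 𝒱 t ⊆ U) {k : κ} (hk : k ∉ U) (a : ℕ → Bool) :
    restrictBy K (toRestr (𝒱 k) a) p = p :=
  restrictBy_eq_self fun t ht j hj => toRestr_of_notMem a fun hjk =>
    hk (hp t ht (mem_nbhd.2 ⟨j, hj, hjk⟩))

/-- **Lemma 3.9/3.11**: for `I ⊇ Sup(U)` with `|I ∖ Sup(U)| ≤ s/2` and `N(p) ⊆ U`, the residues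
of `p` modulo `⟨I ∧ E⟩` and modulo `⟨Sup(U) ∧ E⟩` coincide (remove the extra subformulas one by
one through an escaping respectful boundary set). [Mikša–Nordström 2015, Lemmas 3.9 and 3.11
(arXiv Lemmas 27, 29)] [cite: MiksaNordstrom2015, Lemma 3.11] -/
theorem residue_locSol_eq {U : Finset κ} {I : Finset ι} {p : MvPolynomial ℕ K}
    (hp : ∀ t ∈ p.support, nbhd 𝒱 t ⊆ U) (hI : msupp 𝓕 𝒱 E s U ⊆ I)
    (hB : 2 * ((I \ msupp 𝓕 𝒱 E s U).card : ℝ) ≤ s) :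
    residue (locSol 𝓕 E I) p = residue (locSol 𝓕 E (msupp 𝓕 𝒱 E s U)) p := by
  suffices h : ∀ n (I : Finset ι), (I \ msupp 𝓕 𝒱 E s U).card = n → msupp 𝓕 𝒱 E s U ⊆ I →
      2 * ((I \ msupp 𝓕 𝒱 E s U).card : ℝ) ≤ s →
      residue (locSol 𝓕 E I) p = residue (locSol 𝓕 E (msupp 𝓕 𝒱 E s U)) p from h _ I rfl hI hB
  intro n
  induction n using Nat.strong_induction_on with
  | _ n ih =>
    intro I hn hI hB
    by_cases hIS : I ⊆ msupp 𝓕 𝒱 E s U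
    · rw [Finset.Subset.antisymm hIS hI]
    obtain ⟨i, hiI, hiS, k, -, ⟨-, a, hsat, hres⟩, huniq, hkU⟩ := exists_escape hI hB hIS
    have step : residue (locSol 𝓕 E I) p = residue (locSol 𝓕 E (I.erase i)) p := by
      refine residue_eq_residue_of_restrictBy (locSol_mono (Finset.erase_subset i I))
        (toRestr (𝒱 k) a) fun x hx => ?_
      have hx' : ovr (toRestr (𝒱 k) a) x ∈ locSol 𝓕 E I :=
        ovr_toRestr_mem_locSol hres (fun i' hi' => by
          by_cases h : i' = i
          · subst h; exact Or.inl hsat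
          · exact Or.inr ⟨huniq i' hi' h, Finset.mem_erase.2 ⟨h, hi'⟩⟩) hx
      rw [bval_restrictBy, bval_residue p hx', ← bval_restrictBy, restrictBy_toRestr_eq_self hp hkU]
    rw [step]
    have hlt : ((I.erase i) \ msupp 𝓕 𝒱 E s U).card < n := by
      rw [← hn, Finset.erase_sdiff_comm, Finset.card_erase_of_mem (Finset.mem_sdiff.2 ⟨hiI, hiS⟩)]
      exact Nat.sub_lt (Finset.card_pos.2 ⟨i, Finset.mem_sdiff.2 ⟨hiI, hiS⟩⟩) one_pos
    refine ih _ hlt (I.erase i) rfl (fun i' hi' => Finset.mem_erase.2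
      ⟨fun h => hiS (h ▸ hi'), hI hi'⟩) (le_trans ?_ hB)
    exact_mod_cast Nat.mul_le_mul_left 2 (Finset.card_le_card
      (Finset.sdiff_subset_sdiff (Finset.erase_subset i I) Finset.Subset.rfl))

omit [Fintype ι] [DecidableEq ι] in
/-- **Lemma 3.10** ("reducing a term modulo an ideal does not introduce any new variables outside
of the generators of that ideal"): a variable set respecting `E`, outside `N(p)` and not a
neighbour of `I`, contains no variable of the residue of `p` modulo `⟨I ∧ E⟩`.
[Mikša–Nordström 2015, Lemma 3.10 (arXiv Lemma 28)] [cite: MiksaNordstrom2015, Lemma 3.10] -/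
theorem notMem_nbhd_of_mem_support_residue {U : Finset κ} {I : Finset ι} {p : MvPolynomial ℕ K}
    (hp : ∀ t ∈ p.support, nbhd 𝒱 t ⊆ U) {k : κ} (hkU : k ∉ U) (hkI : k ∉ nbrs 𝓕 𝒱 I)
    (hres : ∃ a, Respects (𝒱 k) a E) {t : ℕ →₀ ℕ}
    (ht : t ∈ (residue (locSol 𝓕 E I) p).support) : k ∉ nbhd 𝒱 t := by
  obtain ⟨a, hres⟩ := hres
  have hfix : restrictBy K (toRestr (𝒱 k) a) (residue (locSol 𝓕 E I) p) =
      residue (locSol 𝓕 E I) p := by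
    refine restrictBy_residue_eq (toRestr (𝒱 k) a) fun x hx => ?_
    have hx' : ovr (toRestr (𝒱 k) a) x ∈ locSol 𝓕 E I :=
      ovr_toRestr_mem_locSol hres (fun i' hi' => Or.inr ⟨fun hn => hkI (mem_nbrs.2 ⟨i', hi', hn⟩),
        hi'⟩) hx
    rw [bval_restrictBy, bval_residue p hx', ← bval_restrictBy, restrictBy_toRestr_eq_self hp hkU]
  intro hk
  obtain ⟨j, hj, hjk⟩ := mem_nbhd.1 hk
  have := eq_none_of_mem_support_restrictBy (K := K) (ρ := toRestr (𝒱 k) a)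
    (p := residue (locSol 𝓕 E I) p) (t := t) (by rwa [hfix]) hj
  rw [toRestr_of_mem a hjk] at this
  exact Option.some_ne_none _ this

/-! ### The three properties of `R` -/

/-- `N` of the (single) monomial of `monomial t a`. [folklore] -/
private theorem nbhd_subset_of_mem_support_monomial {t t' : ℕ →₀ ℕ} {a : K}
    (ht : t' ∈ (monomial t a).support) : nbhd 𝒱 t' ⊆ nbhd 𝒱 t := by
  classical
  rw [Finset.mem_singleton.1 (support_monomial_subset ht)]

/-- **`R` kills local polynomials**: `N(p) ⊆ U` with `|U| ≤ δs/2 - ξ`, and `p` vanishing on the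
common roots of `⟨I ∧ E⟩` for some `I ⊇ Sup(U)` with `|I ∖ Sup(U)| ≤ s/2`, give `R(p) = 0` (all
monomials reduce modulo the same ideal by Lemma 3.11, and the residue is linear) — the argument of
MN15 for "`R` maps axioms to `0`". [Mikša–Nordström 2015, proof of Thm 3.6 (arXiv Thm 11, axiom
case)] [cite: MiksaNordstrom2015, Theorem 3.6] -/
theorem L_eq_zero_of_local {δ ξ : ℝ} (hexp : IsRespExpander 𝓕 𝒱 E s δ ξ) (hδ : 0 < δ)
    (hs : 0 ≤ s) {U : Finset κ} {p : MvPolynomial ℕ K} (hp : ∀ t ∈ p.support, nbhd 𝒱 t ⊆ U)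
    (hU : (U.card : ℝ) ≤ δ * s / 2 - ξ) {I : Finset ι} (hI : msupp 𝓕 𝒱 E s U ⊆ I)
    (hIB : 2 * ((I \ msupp 𝓕 𝒱 E s U).card : ℝ) ≤ s)
    (hvan : ∀ x ∈ locSol 𝓕 E I, bval x p = 0) : L 𝓕 𝒱 E s K p = 0 := by
  have hSr := two_mul_card_msupp_le hexp hδ hs hU
  have h1 : ∀ t ∈ p.support, Lmon 𝓕 𝒱 E s K t = residue (locSol 𝓕 E I) (monomial t 1) := by
    intro t ht
    have hN : ∀ t' ∈ (monomial t (1 : K)).support, nbhd 𝒱 t' ⊆ nbhd 𝒱 t :=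
      fun t' ht' => nbhd_subset_of_mem_support_monomial ht'
    rw [Lmon, ← residue_locSol_eq (I := msupp 𝓕 𝒱 E s U) hN (msupp_mono (hp t ht))
      (le_trans (by exact_mod_cast Nat.mul_le_mul_left 2 (Finset.card_le_card Finset.sdiff_subset))
      hSr), residue_locSol_eq (fun t' ht' => (hN t' ht').trans (hp t ht)) hI hIB]
  rw [L_eq_sum, Finset.sum_congr rfl fun t ht => by rw [h1 t ht, ← residue_smul], ← residue_sum]
  have : ∑ t ∈ p.support, coeff t p • (monomial t (1 : K) : MvPolynomial ℕ K) = p := by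
    conv_rhs => rw [p.as_sum]
    exact Finset.sum_congr rfl fun t _ => by rw [smul_monomial, smul_eq_mul, mul_one]
  rw [this]
  exact residue_eq_zero_of_vanish hvan

/-- Adding the variable `x_j` to a monomial adds `j` to its variables. [folklore] -/
private theorem support_add_single (t : ℕ →₀ ℕ) (j : ℕ) :
    (t + Finsupp.single j 1).support = insert j t.support := by
  classical
  ext i
  simp only [Finsupp.mem_support_iff, Finsupp.add_apply, Finsupp.single_apply, Finset.mem_insert]
  by_cases h : j = i
  · subst h; simp
  · simp [h, Ne.symm h]

/-- **`R(1) ≠ 0`**, in fact `R(1) = 1`: the support of `1` has `≤ s/2` subformulas, which together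
with `E` are satisfiable by hypothesis. [Mikša–Nordström 2015, proof of Thm 3.6]
[cite: MiksaNordstrom2015, Theorem 3.6] -/
theorem L_one {δ ξ : ℝ} (hexp : IsRespExpander 𝓕 𝒱 E s δ ξ) (hδ : 0 < δ) (hs : 0 ≤ s)
    (hξ : 0 ≤ δ * s / 2 - ξ)
    (hsat : ∀ S : Finset ι, (S.card : ℝ) ≤ s → (locSol 𝓕 E S).Nonempty) :
    L 𝓕 𝒱 E s K (1 : MvPolynomial ℕ K) = 1 := by
  rw [show (1 : MvPolynomial ℕ K) = monomial 0 1 from rfl, L_monomial, one_smul, Lmon]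
  have h0 : nbhd 𝒱 (0 : ℕ →₀ ℕ) = ∅ := by
    ext k; simp [mem_nbhd]
  rw [h0]
  have hsmall := two_mul_card_msupp_le hexp hδ hs (U := ∅) (by simpa using hξ)
  exact residue_one (hsat _ (by linarith))

/-! ### Theorem 3.6 -/

/-- Degree bookkeeping: `|N(x_j t)| ≤ ℓ(|t| + 1) ≤ δs/2 - ξ` when `deg t + 1 ≤ D` and
`ℓ D ≤ δs/2 - ξ`. [Mikša–Nordström 2015, Lemma 3.12 (arXiv Lemma 30)] [cite: MiksaNordstrom2015, Lemma 3.12] -/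
theorem card_nbhd_add_single_le {δ ξ : ℝ} {ℓ D : ℕ}
    (hover : ∀ x : ℕ, (Finset.univ.filter fun k => x ∈ 𝒱 k).card ≤ ℓ)
    (hD : (ℓ : ℝ) * D ≤ δ * s / 2 - ξ) {t : ℕ →₀ ℕ} (ht : (t.sum fun _ e => e) + 1 ≤ D) (j : ℕ) :
    ((nbhd 𝒱 (t + Finsupp.single j 1)).card : ℝ) ≤ δ * s / 2 - ξ := by
  classical
  have h1 := card_nbhd_le hover (t + Finsupp.single j 1)
  have h2 : (t + Finsupp.single j 1).support.card ≤ t.support.card + 1 := by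
    rw [support_add_single]; exact Finset.card_insert_le _ _
  have h3 : t.support.card ≤ t.sum fun _ e => e := by
    rw [MLPC.sum_exponents_eq_degree]; exact MLPC.card_support_le_degree t
  have h4 : ((nbhd 𝒱 (t + Finsupp.single j 1)).card : ℝ) ≤ ℓ * D := by
    have : (nbhd 𝒱 (t + Finsupp.single j 1)).card ≤ ℓ * D :=
      h1.trans (Nat.mul_le_mul_left ℓ (by omega))
    exact_mod_cast this
  linarith

end MiksaNordstrom

end Literature.Computability.MetaComplexity
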